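import Literature.NumberTheory.LFunctions.Zhang2022.Section8Step8u012
import Literature.NumberTheory.LFunctions.Zhang2022.Section5Lemma52Holds
import Literature.NumberTheory.LFunctions.Zhang2022.Section5Lemma59Ded

/-!
# Route `ZDegreeToeplitzBand`, crux `PsiGradedTablesClosePoly` (stmt-Parity-22438), line `long_poly_dil`, stub
# `stub_lemma81LongPsiDil` (P2-Dil): the §8 Lemma 8.1 chain RE-RUN AT TWO INDEPENDENT TRUNCATIONS — Part 2,
# the kernel swap `𝒞̃ ↦ 𝒞` on `𝔍(α)` (Z22:§8.u012) for GENERIC data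

Y. Zhang, *Discrete mean estimates and the Landau–Siegel zero*, arXiv:2211.02515v1 — an unrefereed manuscript under
adjudication. **The programme SEARCHES and TYPES; no claim about Landau–Siegel zeros, Theorems 1–2 of arXiv:2211.02515
or a repaired Margin232 until a kernel theorem says so.**

"By Lemma 5.2 and 5.9, `Ĩ₁⁺(𝐚₁,𝐚₂;ψ) − I₁⁺(𝐚₁,𝐚₂;ψ) ≪ 𝓛⁻¹¹⁴∫_{𝔍(α)}|L(s+β₂,ψ)L(s+β₃,ψ)A(𝐚₁;s,ψ)A(𝐚₂,1−s,ψ̄)ω(s)ds|`"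
(§8 p. 43): the tree's `Section8aStatements.step8u012_of_prop22` is typed at `Apoly = dirPoly (Nsupp D)`; the pointwise
inequality `|𝒞̃(s) − 𝒞(s)| ≤ K𝓛⁻¹¹⁴|L(s+β₂)L(s+β₃)|` on `𝔍(α)` (Lemma 5.2 = `Skeleton.lemma52_holds`, Lemma 5.9 =
`Skeleton.lemma59_restricted_of_prop22`) does not see the Dirichlet polynomials, so the step holds verbatim for
`A_{N₁}(a₁;s,ψ)A_{N₂}(a₂;1−s,ψ̄)` with ARBITRARY truncations and coefficients (`lemma81Ext_kernel_swap`). The data enter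
only through the continuity of the two integrands along `𝔍(α)` (`lemma81Ext_continuousOn_tilde_J`, `…_C_J`).
Theorems only; no definitions; no new named facts. Prover: ls-knife-typer-3 g20 (cell landau-siegel §D), `--supports`
stmt-Parity-22438. [cite: Zhang2022LandauSiegel, §8 p. 43, tex L2240–2243; Lemmas 5.2, 5.9]
-/

noncomputable section

open Complex Real Set MeasureTheory intervalIntegral
open Literature.NumberTheory.LFunctions.Zhang2022
open Literature.NumberTheory.LFunctions.Zhang2022.Skeleton
open Literature.NumberTheory.LFunctions.Zhang2022.Section8aStatements
open Literature.NumberTheory.LFunctions.Zhang2022.Step8u012Holds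
open GammaFactor

namespace Summit.Parity.GeneralizedHardyLittlewood.Theorems

section Continuity

variable (c' : ℝ) {D : ℕ} (x : Chr D)

/-- **The kernel `𝒞(s,ψ)` (7.1) is continuous along `𝔍(α)`** on any parameter set where `L(s,ψ) ≠ 0` (`𝓛 ≥ 1`):
`Z(·,ψ)` analytic and non-zero on the upper half-plane, `L(·,ψ)` entire. [cite: Zhang2022LandauSiegel, §7 (7.1); §8 p. 43] -/
theorem lemma81Ext_continuousOn_frakcW_J (hL : 1 ≤ ell D) {S : Set ℝ} (hS : S ⊆ Icc (-ell1 D) (ell1 D))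
    (hL0 : ∀ v ∈ S, x.ψ.LFunction ((alpha D : ℂ) + s0 D + v * I) ≠ 0) :
    ContinuousOn (fun v : ℝ => frakcW c' x ((alpha D : ℂ) + s0 D + v * I)) S := by
  have hsv := continuous_sv D
  have hLc : Continuous x.ψ.LFunction := Ded81Edge.continuous_LFunction_chr x
  have hvabs : ∀ v ∈ S, |v| ≤ ell1 D := fun v hv => abs_le.mpr ⟨(hS hv).1, (hS hv).2⟩
  have him0 : ∀ v ∈ S, 0 < ((alpha D : ℂ) + s0 D + v * I).im := fun v hv => by
    have := im_sv_add_pos hL (hvabs v hv) (y := 0) (by norm_num); simpa using this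
  have hZon : ContinuousOn (Zfac x.ψ) {s : ℂ | 0 < s.im} := fun s hs =>
    (analyticAt_Zfac x.ψ hs).continuousAt.continuousWithinAt
  have hZ : ContinuousOn (fun v : ℝ => (Zfac x.ψ ((alpha D : ℂ) + s0 D + v * I))⁻¹) S := by
    refine ContinuousOn.inv₀ (hZon.comp hsv.continuousOn fun v hv => him0 v hv) fun v hv => ?_
    exact Zfac_ne_zero x.prim (him0 v hv)
  have hL1 : Continuous fun v : ℝ => x.ψ.LFunction ((alpha D : ℂ) + s0 D + v * I + beta1 c' D) :=
    hLc.comp (hsv.add continuous_const)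
  have hL2 : Continuous fun v : ℝ => x.ψ.LFunction ((alpha D : ℂ) + s0 D + v * I + beta2 c' D) :=
    hLc.comp (hsv.add continuous_const)
  have hL3 : Continuous fun v : ℝ => x.ψ.LFunction ((alpha D : ℂ) + s0 D + v * I + beta3 c' D) :=
    hLc.comp (hsv.add continuous_const)
  have hLs : ContinuousOn (fun v : ℝ => x.ψ.LFunction ((alpha D : ℂ) + s0 D + v * I)) S :=
    (hLc.comp hsv).continuousOn
  have h : ContinuousOn (fun v : ℝ =>
      -I * (((x.p : ℝ) * t0 D : ℝ) : ℂ) ^ beta3 c' D * (Zfac x.ψ ((alpha D : ℂ) + s0 D + v * I))⁻¹ *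
        (x.ψ.LFunction ((alpha D : ℂ) + s0 D + v * I + beta1 c' D) *
          x.ψ.LFunction ((alpha D : ℂ) + s0 D + v * I + beta2 c' D) *
          x.ψ.LFunction ((alpha D : ℂ) + s0 D + v * I + beta3 c' D)) /
        x.ψ.LFunction ((alpha D : ℂ) + s0 D + v * I)) S := by
    refine ContinuousOn.div ?_ hLs hL0
    exact (continuousOn_const.mul hZ).mul ((hL1.mul hL2).mul hL3).continuousOn
  refine h.congr fun v _ => ?_
  simp only [frakcW]

/-- **The kernel `𝒞̃(s,ψ) = −iM₁M₂M₃/M` is continuous along `𝔍(α)`** on any parameter set where `L(s,ψ) ≠ 0`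
(`𝓛 ≥ 1`, `|b_j| ≤ 1`): `Y(·,ψ)` analytic and non-zero on the upper half-plane, `M = YL`.
[cite: Zhang2022LandauSiegel, §8 p. 42, tex L2194] -/
theorem lemma81Ext_continuousOn_calCt_J (hL : 1 ≤ ell D) (hb1 : |b1 c' D| ≤ 1) (hb2 : |b2 c' D| ≤ 1)
    (hb3 : |b3 c' D| ≤ 1) {S : Set ℝ} (hS : S ⊆ Icc (-ell1 D) (ell1 D))
    (hL0 : ∀ v ∈ S, x.ψ.LFunction ((alpha D : ℂ) + s0 D + v * I) ≠ 0) :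
    ContinuousOn (fun v : ℝ => calCt c' x ((alpha D : ℂ) + s0 D + v * I)) S := by
  obtain ⟨e1, e2, e3⟩ := beta_eq_b_mul_I c' D
  have hsv := continuous_sv D
  have hLc : Continuous x.ψ.LFunction := Ded81Edge.continuous_LFunction_chr x
  have hvabs : ∀ v ∈ S, |v| ≤ ell1 D := fun v hv => abs_le.mpr ⟨(hS hv).1, (hS hv).2⟩
  have hYd : ContinuousOn (Yroot x.ψ) {s : ℂ | 0 < s.im} := (Yroot_spec x.prim).1.continuousOn
  have him0 : ∀ v ∈ S, 0 < ((alpha D : ℂ) + s0 D + v * I).im := fun v hv => by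
    have := im_sv_add_pos hL (hvabs v hv) (y := 0) (by norm_num); simpa using this
  have him1 : ∀ v ∈ S, 0 < ((alpha D : ℂ) + s0 D + v * I + beta1 c' D).im := fun v hv => by
    rw [e1]; exact im_sv_add_pos hL (hvabs v hv) hb1
  have him2 : ∀ v ∈ S, 0 < ((alpha D : ℂ) + s0 D + v * I + beta2 c' D).im := fun v hv => by
    rw [e2]; exact im_sv_add_pos hL (hvabs v hv) hb2
  have him3 : ∀ v ∈ S, 0 < ((alpha D : ℂ) + s0 D + v * I + beta3 c' D).im := fun v hv => by
    rw [e3]; exact im_sv_add_pos hL (hvabs v hv) hb3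
  have hM : ∀ β : ℂ, (∀ v ∈ S, 0 < ((alpha D : ℂ) + s0 D + v * I + β).im) →
      ContinuousOn (fun v : ℝ => Mfun x.ψ ((alpha D : ℂ) + s0 D + v * I + β)) S := by
    intro β hβ
    have hY : ContinuousOn (fun v : ℝ => Yroot x.ψ ((alpha D : ℂ) + s0 D + v * I + β)) S :=
      hYd.comp (hsv.add continuous_const).continuousOn fun v hv => hβ v hv
    have hLβ : Continuous fun v : ℝ => x.ψ.LFunction ((alpha D : ℂ) + s0 D + v * I + β) :=
      hLc.comp (hsv.add continuous_const)
    exact (hY.mul hLβ.continuousOn).congr fun v _ => by simp only [Mfun, Pi.mul_apply]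
  have hM0 : ContinuousOn (fun v : ℝ => Mfun x.ψ ((alpha D : ℂ) + s0 D + v * I)) S := by
    have := hM 0 (fun v hv => by rw [add_zero]; exact him0 v hv)
    exact this.congr fun v _ => by simp only [add_zero]
  have hM0ne : ∀ v ∈ S, Mfun x.ψ ((alpha D : ℂ) + s0 D + v * I) ≠ 0 := fun v hv =>
    mul_ne_zero (Yroot_ne_zero x (him0 v hv)) (hL0 v hv)
  have h : ContinuousOn (fun v : ℝ =>
      -I * (Mfun x.ψ ((alpha D : ℂ) + s0 D + v * I + beta1 c' D) *
          Mfun x.ψ ((alpha D : ℂ) + s0 D + v * I + beta2 c' D) *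
          Mfun x.ψ ((alpha D : ℂ) + s0 D + v * I + beta3 c' D)) /
        Mfun x.ψ ((alpha D : ℂ) + s0 D + v * I)) S := by
    refine ContinuousOn.div ?_ hM0 hM0ne
    exact continuousOn_const.mul (((hM _ him1).mul (hM _ him2)).mul (hM _ him3))
  refine h.congr fun v _ => ?_
  simp only [calCt]

/-- The data factor `A_{N₁}(a₁;s,ψ)A_{N₂}(a₂;1−s,ψ̄)ω(s)` is continuous along `𝔍(α)` (entire functions).
[cite: Zhang2022LandauSiegel, §8 p. 43] -/
theorem lemma81Ext_continuous_AAω (N₁ N₂ : ℕ) (a₁ a₂ : ℕ → ℂ) :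
    Continuous fun v : ℝ => Lemma81.dirPoly N₁ a₁ x.ψ ((alpha D : ℂ) + s0 D + v * I) *
      Lemma81.dirPoly N₂ a₂ x.ψ⁻¹ (1 - ((alpha D : ℂ) + s0 D + v * I)) * omegaW D ((alpha D : ℂ) + s0 D + v * I) := by
  have hsv := continuous_sv D
  exact (((Ded81Edge.continuous_dirPoly N₁ a₁ x.ψ x.p_ne_one).comp hsv).mul
    ((Ded81Edge.continuous_dirPoly N₂ a₂ x.ψ⁻¹ x.p_ne_one).comp (continuous_const.sub hsv))).mul
    ((Ded81Edge.continuous_omega (ell2 D) (t0 D)).comp hsv)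

end Continuity

/-! ### Z22:§8.u012 at two truncations -/

section KernelSwap

variable {c' : ℝ}

/-- The algebra of the integrand difference: `𝒞̃·(AĀω) − 𝒞·A·Ā·ω = −i(Y₁Y₂Y₃/Y − (pt₀)^{β₃}Z⁻¹)·(L₁/L)·(L₂L₃)·(AĀω)`
(`M = YL`), for ANY factor `A·Ā·ω`. [cite: Zhang2022LandauSiegel, §8 p. 43, tex L2240–2243] -/
theorem lemma81Ext_tilde_sub_C {D : ℕ} (x : Chr D) (W s : ℂ) :
    calCt c' x s * W - frakcW c' x s * W =
      -I * (Yroot x.ψ (s + beta1 c' D) * Yroot x.ψ (s + beta2 c' D) * Yroot x.ψ (s + beta3 c' D) /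
              Yroot x.ψ s -
            (((x.p : ℝ) * t0 D : ℝ) : ℂ) ^ beta3 c' D * (Zfac x.ψ s)⁻¹) *
        (x.ψ.LFunction (s + beta1 c' D) / x.ψ.LFunction s) *
        (x.ψ.LFunction (s + beta2 c' D) * x.ψ.LFunction (s + beta3 c' D)) * W := by
  simp only [calCt, frakcW, Mfun]
  ring

/-- **Z22:§8.u012 AT TWO INDEPENDENT TRUNCATIONS, for generic data** ("By Lemma 5.2 and 5.9,
`Ĩ₁⁺ − I₁⁺ ≪ 𝓛⁻¹¹⁴∫_{𝔍(α)}|L(s+β₂,ψ)L(s+β₃,ψ)A(𝐚₁;s,ψ)A(𝐚₂,1−s,ψ̄)ω(s)ds|`"): for `c′ ≥ 0` with `Prop22 c′` there is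
`C` such that for all large `D`, under (A), for every `ψ ∈ Ψ₁` and ALL truncations `N₁, N₂` and coefficients `a₁, a₂`,
`‖(1/2πi)∫_{𝔍(α)}𝒞̃·A_{N₁}(a₁)A_{N₂}(a₂;1−·)ω − (1/2πi)∫_{𝔍(α)}𝒞·A_{N₁}(a₁)A_{N₂}(a₂;1−·)ω‖
 ≤ C𝓛⁻¹¹⁴∫_{−𝓛₁}^{𝓛₁}|L(s+β₂)L(s+β₃)·A_{N₁}(a₁;s)A_{N₂}(a₂;1−s)ω(s)|dv`, `s = α + s₀ + iv`, `C = C₅₂e¹¹C₅₉/(2π)`.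
[cite: Zhang2022LandauSiegel, §8 p. 43, tex L2240–2243; Lemmas 5.2, 5.9] -/
theorem lemma81Ext_kernel_swap (hc' : 0 ≤ c') (h22 : Prop22 c') :
    ∃ C : ℝ, ForAllLarge fun D _ χ => AssumptionA D χ → ∀ x ∈ PsiOne χ, ∀ (N₁ N₂ : ℕ) (a₁ a₂ : ℕ → ℂ),
      ‖Lemma81.segInt (t0 D) (ell1 D) ((alpha D : ℝ) : ℂ) (fun s => calCt c' x s *
            (Lemma81.dirPoly N₁ a₁ x.ψ s * Lemma81.dirPoly N₂ a₂ x.ψ⁻¹ (1 - s) * omegaW D s)) -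
          Lemma81.segInt (t0 D) (ell1 D) ((alpha D : ℝ) : ℂ) (fun s =>
            frakcW c' x s * Lemma81.dirPoly N₁ a₁ x.ψ s * Lemma81.dirPoly N₂ a₂ x.ψ⁻¹ (1 - s) * omegaW D s)‖ ≤
        C * (ell D ^ 114)⁻¹ * ∫ v in (-ell1 D)..ell1 D,
          ‖x.ψ.LFunction (((alpha D : ℝ) : ℂ) + s0 D + v * I + beta2 c' D) *
              x.ψ.LFunction (((alpha D : ℝ) : ℂ) + s0 D + v * I + beta3 c' D) *
            (Lemma81.dirPoly N₁ a₁ x.ψ (((alpha D : ℝ) : ℂ) + s0 D + v * I) *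
              Lemma81.dirPoly N₂ a₂ x.ψ⁻¹ (1 - (((alpha D : ℝ) : ℂ) + s0 D + v * I)) *
              omegaW D (((alpha D : ℝ) : ℂ) + s0 D + v * I))‖ := by
  obtain ⟨C₂, D₂, h52⟩ := lemma52_holds c'
  obtain ⟨C₉, D₉, h59⟩ := lemma59_restricted_of_prop22 hc' h22 1 one_pos
  obtain ⟨D₁, hi⟩ := h22.1
  set K : ℝ := max C₂ 0 * Real.exp 11 * max C₉ 0 with hKdef
  have hK0 : 0 ≤ K := by rw [hKdef]; positivity
  refine ⟨K / (2 * Real.pi), max (max D₁ (max D₂ D₉)) ⌈Real.exp (32 + 40 * c')⌉₊,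
    fun D _ χ hD hq hp _hA x hx N₁ N₂ a₁ a₂ => ?_⟩
  -- thresholds
  have hD₁ : D₁ ≤ D := le_trans (le_trans (le_max_left _ _) (le_max_left _ _)) hD
  have hD₂ : D₂ ≤ D :=
    le_trans (le_trans (le_trans (le_max_left _ _) (le_max_right _ _)) (le_max_left _ _)) hD
  have hD₉ : D₉ ≤ D :=
    le_trans (le_trans (le_trans (le_max_right _ _) (le_max_right _ _)) (le_max_left _ _)) hD
  have hDceil : ⌈Real.exp (32 + 40 * c')⌉₊ ≤ D := le_trans (le_max_right _ _) hD
  have hexp : Real.exp (32 + 40 * c') ≤ D := le_trans (Nat.le_ceil _) (by exact_mod_cast hDceil)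
  have hD0 : (0 : ℝ) < D := lt_of_lt_of_le (Real.exp_pos _) hexp
  have hLc : 32 + 40 * c' ≤ ell D := (Real.le_log_iff_exp_le hD0).mpr hexp
  have hL : 32 ≤ ell D := by linarith
  have hL1 : 1 ≤ ell D := by linarith
  obtain ⟨hα0, hα100, hb1, hb2, hb3, ht0pos⟩ := scales8 hc' hLc
  have hα4 : alpha D ≤ 1 / 4 := by linarith
  have hlogP : Real.log (bigP D) = ell D ^ 9 := by rw [bigP, Real.log_exp]
  have hix := hi D χ hD₁ hq hp x hx
  have h52x := h52 D χ hD₂ hq hp x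
  have h59x := h59 D χ hD₉ hq hp x hx
  -- abbreviations: the point of `𝔍(α)`, the data factor, the two integrands, the majorant
  set sv : ℝ → ℂ := fun v => ((alpha D : ℝ) : ℂ) + s0 D + v * I with hsv_def
  set W : ℂ → ℂ := fun s => Lemma81.dirPoly N₁ a₁ x.ψ s * Lemma81.dirPoly N₂ a₂ x.ψ⁻¹ (1 - s) * omegaW D s
    with hW_def
  have hsv_re : ∀ v : ℝ, (sv v).re = 1 / 2 + alpha D := fun v => by
    simp [hsv_def, s0, SmoothWeight.s0_def]; ring
  have hsv_im : ∀ v : ℝ, (sv v).im = 2 * π * t0 D + v := fun v => by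
    simp [hsv_def, s0, SmoothWeight.s0_def]
  have hfar : ∀ v : ℝ, |v| ≤ ell1 D → ∀ ρ : ℂ, x.ψ.LFunction ρ = 0 → 1 * alpha D ≤ ‖sv v - ρ‖ := by
    intro v hv ρ hρ
    rw [one_mul]
    exact alpha_le_norm_sub_of_prop22i χ x hα0.le hα4 hix (hsv_re v)
      (by rw [hsv_im, show 2 * π * t0 D + v - 2 * π * t0 D = v by ring]; exact hv) ρ hρ
  have hLne : ∀ v ∈ Icc (-ell1 D) (ell1 D), x.ψ.LFunction (sv v) ≠ 0 := by
    intro v hv h0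
    have h := hfar v (abs_le.mpr ⟨hv.1, hv.2⟩) _ h0
    rw [sub_self, norm_zero] at h
    linarith
  -- pointwise: `‖𝒞̃W − 𝒞W‖ ≤ K𝓛⁻¹¹⁴‖L(s+β₂)L(s+β₃)W‖`
  have hpt : ∀ v ∈ Icc (-ell1 D) (ell1 D),
      ‖calCt c' x (sv v) * W (sv v) - frakcW c' x (sv v) * W (sv v)‖ ≤
        K * (ell D ^ 114)⁻¹ *
          ‖x.ψ.LFunction (sv v + beta2 c' D) * x.ψ.LFunction (sv v + beta3 c' D) * W (sv v)‖ := by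
    intro v hv
    have hvabs : |v| ≤ ell1 D := abs_le.mpr ⟨hv.1, hv.2⟩
    have hIn : InRange51 D (sv v) := by
      refine ⟨?_, ?_⟩
      · rw [hsv_re, show (1 : ℝ) / 2 + alpha D - 1 / 2 = alpha D by ring, abs_of_pos hα0]
      · rw [hsv_im, show 2 * π * t0 D + v - 2 * π * t0 D = v by ring]; linarith
    have h2 := h52x (sv v) hIn
    have h9 := h59x (sv v)
      (by rw [hsv_re, show (1 : ℝ) / 2 + alpha D - 1 / 2 = alpha D by ring, abs_of_pos hα0])
      (by rw [hsv_im, show 2 * π * t0 D + v - 2 * π * t0 D = v by ring]; linarith) (hfar v hvabs)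
    have hL0pos : 0 < ‖x.ψ.LFunction (sv v)‖ := norm_pos_iff.mpr (hLne v hv)
    have hZ := norm_coeff_Zinv_le (c' := c') hL hα0 hα100 x hvabs
    have hYq_le : ‖Yroot x.ψ (sv v + beta1 c' D) * Yroot x.ψ (sv v + beta2 c' D) *
            Yroot x.ψ (sv v + beta3 c' D) / Yroot x.ψ (sv v) -
          (((x.p : ℝ) * t0 D : ℝ) : ℂ) ^ beta3 c' D * (Zfac x.ψ (sv v))⁻¹‖ ≤
        max C₂ 0 * (ell D ^ 123)⁻¹ * Real.exp 11 := by
      refine h2.trans ?_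
      calc C₂ * (ell D ^ 123)⁻¹ * ‖(((x.p : ℝ) * t0 D : ℝ) : ℂ) ^ beta3 c' D * (Zfac x.ψ (sv v))⁻¹‖
          ≤ max C₂ 0 * (ell D ^ 123)⁻¹ *
            ‖(((x.p : ℝ) * t0 D : ℝ) : ℂ) ^ beta3 c' D * (Zfac x.ψ (sv v))⁻¹‖ := by
            gcongr; exact le_max_left _ _
        _ ≤ max C₂ 0 * (ell D ^ 123)⁻¹ * Real.exp 11 := by gcongr
    have hratio : ‖x.ψ.LFunction (sv v + beta1 c' D) / x.ψ.LFunction (sv v)‖ ≤ max C₉ 0 * ell D ^ 9 := by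
      rw [← hlogP]
      refine h9.trans ?_
      have hlog0 : 0 ≤ Real.log (bigP D) := by rw [hlogP]; positivity
      exact mul_le_mul_of_nonneg_right (le_max_left _ _) hlog0
    have hprod : ‖Yroot x.ψ (sv v + beta1 c' D) * Yroot x.ψ (sv v + beta2 c' D) *
            Yroot x.ψ (sv v + beta3 c' D) / Yroot x.ψ (sv v) -
          (((x.p : ℝ) * t0 D : ℝ) : ℂ) ^ beta3 c' D * (Zfac x.ψ (sv v))⁻¹‖ *
        ‖x.ψ.LFunction (sv v + beta1 c' D) / x.ψ.LFunction (sv v)‖ ≤ K * (ell D ^ 114)⁻¹ := by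
      refine (mul_le_mul hYq_le hratio (norm_nonneg _) (by positivity)).trans (le_of_eq ?_)
      rw [hKdef]
      have hLne0 : ell D ≠ 0 := by linarith
      field_simp
    rw [lemma81Ext_tilde_sub_C x (W (sv v)) (sv v)]
    calc ‖-I * (Yroot x.ψ (sv v + beta1 c' D) * Yroot x.ψ (sv v + beta2 c' D) *
              Yroot x.ψ (sv v + beta3 c' D) / Yroot x.ψ (sv v) -
            (((x.p : ℝ) * t0 D : ℝ) : ℂ) ^ beta3 c' D * (Zfac x.ψ (sv v))⁻¹) *
          (x.ψ.LFunction (sv v + beta1 c' D) / x.ψ.LFunction (sv v)) *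
          (x.ψ.LFunction (sv v + beta2 c' D) * x.ψ.LFunction (sv v + beta3 c' D)) * W (sv v)‖
        = ‖Yroot x.ψ (sv v + beta1 c' D) * Yroot x.ψ (sv v + beta2 c' D) *
              Yroot x.ψ (sv v + beta3 c' D) / Yroot x.ψ (sv v) -
            (((x.p : ℝ) * t0 D : ℝ) : ℂ) ^ beta3 c' D * (Zfac x.ψ (sv v))⁻¹‖ *
          ‖x.ψ.LFunction (sv v + beta1 c' D) / x.ψ.LFunction (sv v)‖ *
          ‖x.ψ.LFunction (sv v + beta2 c' D) * x.ψ.LFunction (sv v + beta3 c' D) * W (sv v)‖ := by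
          simp only [norm_mul, norm_neg, Complex.norm_I, one_mul]
          ring
      _ ≤ K * (ell D ^ 114)⁻¹ *
          ‖x.ψ.LFunction (sv v + beta2 c' D) * x.ψ.LFunction (sv v + beta3 c' D) * W (sv v)‖ :=
          mul_le_mul_of_nonneg_right hprod (norm_nonneg _)
  -- integrability along `𝔍(α)`
  have hℓ0 : (0 : ℝ) ≤ ell1 D := by rw [ell1]; positivity
  have hℓ : (-ell1 D) ≤ ell1 D := by linarith
  have huIcc : Set.uIcc (-ell1 D) (ell1 D) = Icc (-ell1 D) (ell1 D) := Set.uIcc_of_le hℓ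
  have hWc : Continuous fun v : ℝ => W (sv v) := lemma81Ext_continuous_AAω x N₁ N₂ a₁ a₂
  have hcontT : ContinuousOn (fun v : ℝ => calCt c' x (sv v) * W (sv v)) (Icc (-ell1 D) (ell1 D)) :=
    (lemma81Ext_continuousOn_calCt_J c' x hL1 hb1 hb2 hb3 Subset.rfl hLne).mul hWc.continuousOn
  have hcontC : ContinuousOn (fun v : ℝ => frakcW c' x (sv v) * W (sv v)) (Icc (-ell1 D) (ell1 D)) :=
    (lemma81Ext_continuousOn_frakcW_J c' x hL1 Subset.rfl hLne).mul hWc.continuousOn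
  have hIT : IntervalIntegrable (fun v : ℝ => calCt c' x (sv v) * W (sv v)) volume (-ell1 D) (ell1 D) :=
    (hcontT.mono (by rw [huIcc])).intervalIntegrable
  have hIC : IntervalIntegrable (fun v : ℝ => frakcW c' x (sv v) * W (sv v)) volume (-ell1 D) (ell1 D) :=
    (hcontC.mono (by rw [huIcc])).intervalIntegrable
  have hLcont : Continuous x.ψ.LFunction := Ded81Edge.continuous_LFunction_chr x
  have hsvc : Continuous sv := continuous_sv D
  have hmaj : Continuous fun v : ℝ =>
      ‖x.ψ.LFunction (sv v + beta2 c' D) * x.ψ.LFunction (sv v + beta3 c' D) * W (sv v)‖ := by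
    refine Continuous.norm ((Continuous.mul ?_ ?_).mul hWc)
    · exact hLcont.comp (hsvc.add continuous_const)
    · exact hLcont.comp (hsvc.add continuous_const)
  -- the difference of the two segment integrals
  have hs0 : SmoothWeight.s0 (t0 D) = s0 D := rfl
  have hFC : (fun s => frakcW c' x s * Lemma81.dirPoly N₁ a₁ x.ψ s * Lemma81.dirPoly N₂ a₂ x.ψ⁻¹ (1 - s) *
      omegaW D s) = fun s => frakcW c' x s * W s := by
    funext s; simp only [hW_def]; ring
  have hdiff : Lemma81.segInt (t0 D) (ell1 D) ((alpha D : ℝ) : ℂ) (fun s => calCt c' x s * W s) -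
      Lemma81.segInt (t0 D) (ell1 D) ((alpha D : ℝ) : ℂ) (fun s => frakcW c' x s * W s) =
      (1 / (2 * π) : ℂ) * ∫ v in (-ell1 D)..ell1 D,
        (calCt c' x (sv v) * W (sv v) - frakcW c' x (sv v) * W (sv v)) := by
    rw [Lemma81.segInt_def, Lemma81.segInt_def, hs0, ← mul_sub, ← intervalIntegral.integral_sub hIT hIC]
  rw [hFC, hdiff, norm_mul]
  have hnorm2π : ‖(1 / (2 * π) : ℂ)‖ = 1 / (2 * π) := by
    rw [show (1 / (2 * π) : ℂ) = ((1 / (2 * π) : ℝ) : ℂ) by push_cast; ring, Complex.norm_real,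
      Real.norm_eq_abs, abs_of_pos (by positivity)]
  rw [hnorm2π]
  have hint : ‖∫ v in (-ell1 D)..ell1 D, (calCt c' x (sv v) * W (sv v) - frakcW c' x (sv v) * W (sv v))‖
      ≤ ∫ v in (-ell1 D)..ell1 D, K * (ell D ^ 114)⁻¹ *
          ‖x.ψ.LFunction (sv v + beta2 c' D) * x.ψ.LFunction (sv v + beta3 c' D) * W (sv v)‖ := by
    refine (intervalIntegral.norm_integral_le_integral_norm hℓ).trans ?_
    exact intervalIntegral.integral_mono_on hℓ (hIT.sub hIC).norm
      ((hmaj.const_mul _).intervalIntegrable _ _) fun v hv => hpt v hv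
  rw [intervalIntegral.integral_const_mul] at hint
  have h2π : (0 : ℝ) ≤ 1 / (2 * π) := by positivity
  calc 1 / (2 * π) * ‖∫ v in (-ell1 D)..ell1 D,
          (calCt c' x (sv v) * W (sv v) - frakcW c' x (sv v) * W (sv v))‖
      ≤ 1 / (2 * π) * (K * (ell D ^ 114)⁻¹ * ∫ v in (-ell1 D)..ell1 D,
          ‖x.ψ.LFunction (sv v + beta2 c' D) * x.ψ.LFunction (sv v + beta3 c' D) * W (sv v)‖) :=
        mul_le_mul_of_nonneg_left hint h2π
    _ = K / (2 * π) * (ell D ^ 114)⁻¹ * ∫ v in (-ell1 D)..ell1 D,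
          ‖x.ψ.LFunction (sv v + beta2 c' D) * x.ψ.LFunction (sv v + beta3 c' D) * W (sv v)‖ := by ring

end KernelSwap

end Summit.Parity.GeneralizedHardyLittlewood.Theorems

end
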